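import Literature.NumberTheory.LFunctions.LargeValuesS3Integral
import Literature.NumberTheory.LFunctions.LargeValuesSmoothedR
import HarnessLib

/-!
# Localisation of the `I_m` integrals: Guth–Maynard Proposition 7.2 (term by term)

Topic `NumberTheory/LFunctions`, family RH. Continuation of `LargeValuesS3Integral.lean` (Proposition 7.1:
`|I_m| ≤ N³∫∫_{[1/2,2]²} |R(v₁)||R(v₂/v₁)||R(v₂)| D(1+|N(m₁v₁+m₂v₂+m₃)|)^{-j}`) and
`LargeValuesSmoothedR.lean` (the smoothed local mean square `f_B = φ_B ⋆ (ψ_in|R|²)`, eq. (7.5)) in the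
programme around the tree's named fact `Literature.NumberTheory.LFunctions.zeroDensity_guth_maynard`
(L. Guth, J. Maynard, *New large value estimates for Dirichlet polynomials*, Ann. of Math. 203 (2026)).
This file PROVES the step from Proposition 7.1 to Proposition 7.2 of the paper for a single `m` with
`|m₂| ≥ M₂ ≥ 1`, at the scale `B = NM₂N^{-η}` (the paper's `1/(MN)`-neighbourhood thickened by `T^{o(1)}`):

* §1 the local mean squares are dominated by `f_B`:
  `∫_{[1/2,2]∩[c−1/B,c+1/B]} |R(v)|² dv ≤ f_B(c)/B` and, after the substitution `v = v₁u`,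
  `∫_{[1/2,2]∩[c−1/B,c+1/B]} |R(v/v₁)|² dv ≤ 2f_B(c/v₁)/B` (`setIntegral_normSq_le_fB`,
  `setIntegral_normSq_div_le_fB`);
* §2 Cauchy–Schwarz in `v₂` ("Using Cauchy–Schwarz (and a change of variables `v₂ ↦ v₂v₁` for the first
  factor), we bound the inner integral by …"): for a weight `0 ≤ wt ≤ D` with `wt ≤ δ₀` off `[c−1/B, c+1/B]`,
  `∫_{[1/2,2]} |R(v/v₁)||R(v)| wt(v) dv ≤ (√2 D/B) f_B(c/v₁)^{1/2} f_B(c)^{1/2} + (3/2)δ₀|W|²` (`inner_le`);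
* §3 **Proposition 7.2 for one term**: for `η > 0` and `j` there is `C` with
  `|I_m| ≤ C (N³/B) ∫_{[1/2,2]} |R(v)| f_B(A_m v)^{1/2} f_B(B_m v)^{1/2} dv + C N³|W|³N^{-ηj}`
  for `N ≥ 1`, `1 ≤ M₂ ≤ |m₂|`, `B = NM₂N^{-η}`, where `B_m(v) = (m₁v+m₃)/(−m₂)` and `A_m(v) = B_m(v)/v`
  (`norm_Im_le_localised`; "`|I_{m₁,m₂,m₃}| ≪ (N²/M) Ĩ_{m₁,−m₂,m₃} + O(T^{-100})`", with `Ĩ` written with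
  `f_B = B^{-1}R̃²`), stated for the majorant `ImMajorant` of Proposition 7.1, which is symmetric under
  `(m₁,v₁) ↔ (m₂,v₂)` (`majorant_swap`), so that the blocks with `|m₁| ≥ M₁` are covered as well
  (`norm_Im_le_localised_fst`).

* §4 the dyadic shells `shell M₀ i = {m ∈ 𝓜_{M₀} : ⌊log₂|m|⌋ = i}` of `𝓜`, their size, symmetry and the
  decomposition of `∑_{m ∈ 𝓜³}` into blocks (`sum_Mset3_eq_sum_blocks`), used in the assembly of
  Proposition 10.1.

Definitions (with bodies): `affB`, `affA`, `ImMajorant`, `shell`. No named fact is introduced; everything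
in this file is proved.

## References

* L. Guth, J. Maynard, *New large value estimates for Dirichlet polynomials*, Ann. of Math. (2)
  203 (2026), no. 2; arXiv:2405.20552 (2024): §7, Proposition 7.2 and its proof, eq. (7.5).
-/

noncomputable section

open Real Set Filter Topology Complex MeasureTheory Finset
open scoped FourierTransform ContDiff Convolution

namespace Literature.NumberTheory.LFunctions

namespace GuthMaynardS3Loc

open GuthMaynardFourier GuthMaynardRFunction GuthMaynardS3 GuthMaynardSmoothR

/-! ## §1. Local mean squares of `R` are dominated by `f_B` -/

/-- The centre `B_m(v₁) = (m₁v₁ + m₃)/(−m₂)` of the `v₂`-localisation. [cite: GuthMaynard2026, Proposition 7.2] -/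
def affB (m : ℤ × ℤ × ℤ) (v : ℝ) : ℝ := -((m.1 : ℝ) * v + m.2.2) / m.2.1

/-- `A_m(v₁) = B_m(v₁)/v₁ = (m₁v₁ + m₃)/(−m₂v₁)`. [cite: GuthMaynard2026, Proposition 7.2] -/
def affA (m : ℤ × ℤ × ℤ) (v : ℝ) : ℝ := affB m v / v

/-- `N(m₁v₁ + m₂v₂ + m₃) = Nm₂(v₂ − B_m(v₁))` (`m₂ ≠ 0`). [cite: GuthMaynard2026, proof of Proposition 7.2] -/
theorem theta_eq (N : ℕ) (m : ℤ × ℤ × ℤ) (hm : m.2.1 ≠ 0) (v₁ v₂ : ℝ) :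
    theta N m v₁ v₂ = (N : ℝ) * m.2.1 * (v₂ - affB m v₁) := by
  have h : (m.2.1 : ℝ) ≠ 0 := by exact_mod_cast hm
  simp only [theta, affB]
  field_simp; ring

/-- On `[1/4, 4]`, `|R(v)|² = g_W(v)` (`ψ_in = 1` there); everywhere `1_{[1/4,4]}|R|² ≤ g_W`. [folklore] -/
theorem indicator_normSq_le_gW (W : Finset ℝ) (v : ℝ) :
    (Set.Icc (1 / 4 : ℝ) 4).indicator (fun v ↦ ‖Rfun W v‖ ^ 2) v ≤ gW W v := by
  by_cases hv : v ∈ Set.Icc (1 / 4 : ℝ) 4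
  · rw [Set.indicator_of_mem hv, gW, psiIn_eq_one hv.1 hv.2, one_mul]
  · rw [Set.indicator_of_notMem hv]; exact gW_nonneg W v

/-- **`∫_{[1/2,2]∩[c−1/B,c+1/B]} |R|² ≤ f_B(c)/B`** (`B > 0`). [cite: GuthMaynard2026, proof of Proposition 7.2] -/
theorem setIntegral_normSq_le_fB (W : Finset ℝ) {B : ℝ} (hB : 0 < B) (c : ℝ) :
    ∫ v in Set.Icc (1 / 2 : ℝ) 2 ∩ Set.Icc (c - 1 / B) (c + 1 / B), ‖Rfun W v‖ ^ 2 ≤ fB W B c / B := by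
  have h1 := integral_indicator_le_fB W hB c
  rw [le_div_iff₀ hB, mul_comm]
  refine le_trans ?_ h1
  refine mul_le_mul_of_nonneg_left ?_ hB.le
  rw [← integral_indicator (measurableSet_Icc.inter measurableSet_Icc), ← integral_indicator measurableSet_Icc]
  refine integral_mono_of_nonneg (Eventually.of_forall fun v ↦ Set.indicator_nonneg (fun _ _ ↦ sq_nonneg _) _)
    ((integrable_indicator_iff measurableSet_Icc).mpr (gW_integrable W).integrableOn)
    (Eventually.of_forall fun v ↦ ?_)
  by_cases hv : v ∈ Set.Icc (1 / 2 : ℝ) 2 ∩ Set.Icc (c - 1 / B) (c + 1 / B)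
  · rw [Set.indicator_of_mem hv]
    have hv' : v ∈ Set.Icc (c - 2 / B) (c + 2 / B) := by
      obtain ⟨-, h2⟩ := hv
      rw [Set.mem_Icc] at h2 ⊢
      have : 1 / B ≤ 2 / B := by gcongr; norm_num
      constructor <;> linarith
    rw [Set.indicator_of_mem hv']
    have := indicator_normSq_le_gW W v
    rwa [Set.indicator_of_mem (show v ∈ Set.Icc (1 / 4 : ℝ) 4 from
      ⟨by linarith [hv.1.1], by linarith [hv.1.2]⟩)] at this
  · rw [Set.indicator_of_notMem hv]
    exact Set.indicator_nonneg (fun _ _ ↦ gW_nonneg W _) _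

/-- **`∫_{[1/2,2]∩[c−1/B,c+1/B]} |R(v/v₁)|² dv ≤ 2 f_B(c/v₁)/B`** for `v₁ ∈ [1/2,2]`, `B > 0` (the
substitution `v = v₁u`). [cite: GuthMaynard2026, proof of Proposition 7.2] -/
theorem setIntegral_normSq_div_le_fB (W : Finset ℝ) {B : ℝ} (hB : 0 < B) (c : ℝ) {v₁ : ℝ}
    (hv₁ : v₁ ∈ Set.Icc (1 / 2 : ℝ) 2) :
    ∫ v in Set.Icc (1 / 2 : ℝ) 2 ∩ Set.Icc (c - 1 / B) (c + 1 / B), ‖Rfun W (v / v₁)‖ ^ 2 ≤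
      2 * fB W B (c / v₁) / B := by
  have hv₁0 : 0 < v₁ := by linarith [hv₁.1]
  set S : Set ℝ := Set.Icc (1 / 2 : ℝ) 2 ∩ Set.Icc (c - 1 / B) (c + 1 / B) with hS
  have hSm : MeasurableSet S := measurableSet_Icc.inter measurableSet_Icc
  set h : ℝ → ℝ := S.indicator fun v ↦ ‖Rfun W (v / v₁)‖ ^ 2 with hh
  -- substitution
  have hsub : ∫ v, h v = v₁ * ∫ u, h (v₁ * u) := by
    have := Measure.integral_comp_mul_left h v₁
    rw [this, smul_eq_mul, ← mul_assoc, abs_inv, abs_of_pos hv₁0, mul_inv_cancel₀ hv₁0.ne', one_mul]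
  -- the transformed integrand is dominated by `1_{J''} g_W`
  set J : Set ℝ := Set.Icc (c / v₁ - 2 / B) (c / v₁ + 2 / B) with hJ
  have hdom : ∀ u, h (v₁ * u) ≤ J.indicator (gW W) u := by
    intro u
    simp only [hh]
    by_cases hu : v₁ * u ∈ S
    · rw [Set.indicator_of_mem hu, mul_div_cancel_left₀ _ hv₁0.ne']
      obtain ⟨h1, h2⟩ := hu
      rw [Set.mem_Icc] at h1 h2
      have huI : 1 / 4 ≤ u ∧ u ≤ 4 := by
        constructor
        · by_contra hc; push Not at hc; nlinarith [hv₁.2]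
        · by_contra hc; push Not at hc; nlinarith [hv₁.1]
      have huJ : u ∈ J := by
        rw [hJ, Set.mem_Icc]
        have e1 : c / v₁ - 2 / B ≤ u ↔ c - 2 * v₁ / B ≤ v₁ * u := by
          rw [show c / v₁ - 2 / B = (c - 2 * v₁ / B) / v₁ by field_simp, div_le_iff₀ hv₁0, mul_comm u v₁]
        have e2 : u ≤ c / v₁ + 2 / B ↔ v₁ * u ≤ c + 2 * v₁ / B := by
          rw [show c / v₁ + 2 / B = (c + 2 * v₁ / B) / v₁ by field_simp, le_div_iff₀ hv₁0, mul_comm u v₁]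
        rw [e1, e2]
        have : 2 * v₁ / B ≥ 1 / B := by
          rw [ge_iff_le, div_le_div_iff_of_pos_right hB]; linarith [hv₁.1]
        constructor <;> linarith
      rw [Set.indicator_of_mem huJ]
      have := indicator_normSq_le_gW W u
      rwa [Set.indicator_of_mem (show u ∈ Set.Icc (1 / 4 : ℝ) 4 from huI)] at this
    · rw [Set.indicator_of_notMem hu]
      exact Set.indicator_nonneg (fun _ _ ↦ gW_nonneg W _) _
  have hJi : Integrable (J.indicator (gW W)) :=
    (integrable_indicator_iff measurableSet_Icc).mpr (gW_integrable W).integrableOn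
  -- integrability of `u ↦ h(v₁u)`: bounded, measurable, supported in `J`
  have hhm : AEStronglyMeasurable (fun u ↦ h (v₁ * u)) volume := by
    have hm : Measurable h := by
      refine Measurable.indicator ?_ hSm
      exact ((measurable_Rfun W).comp (measurable_id.div_const v₁)).norm.pow_const 2
    exact (hm.comp (measurable_const.mul measurable_id)).aestronglyMeasurable
  have hhi : Integrable (fun u ↦ h (v₁ * u)) := by
    refine Integrable.mono' hJi hhm (Eventually.of_forall fun u ↦ ?_)
    rw [Real.norm_of_nonneg (by simp only [hh]; exact Set.indicator_nonneg (fun _ _ ↦ sq_nonneg _) _)]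
    exact hdom u
  have hmain : ∫ u, h (v₁ * u) ≤ fB W B (c / v₁) / B := by
    calc ∫ u, h (v₁ * u) ≤ ∫ u, J.indicator (gW W) u := integral_mono hhi hJi hdom
      _ = ∫ u in J, gW W u := integral_indicator measurableSet_Icc
      _ ≤ fB W B (c / v₁) / B := by
          rw [le_div_iff₀ hB, mul_comm]
          exact integral_indicator_le_fB W hB (c / v₁)
  calc ∫ v in S, ‖Rfun W (v / v₁)‖ ^ 2 = ∫ v, h v := (integral_indicator hSm).symm
    _ = v₁ * ∫ u, h (v₁ * u) := hsub
    _ ≤ 2 * (fB W B (c / v₁) / B) :=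
        mul_le_mul hv₁.2 hmain (integral_nonneg fun u ↦ by
          simp only [hh]; exact Set.indicator_nonneg (fun _ _ ↦ sq_nonneg _) _) zero_le_two
    _ = 2 * fB W B (c / v₁) / B := by ring

/-! ## §2. Cauchy–Schwarz in `v₂` -/

/-- **Cauchy–Schwarz on the localised set**:
`∫_{[1/2,2]∩[c−1/B,c+1/B]} |R(v/v₁)||R(v)| ≤ (√2/B) f_B(c/v₁)^{1/2} f_B(c)^{1/2}`.
[cite: GuthMaynard2026, proof of Proposition 7.2] -/
theorem setIntegral_prod_le (W : Finset ℝ) {B : ℝ} (hB : 0 < B) (c : ℝ) {v₁ : ℝ}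
    (hv₁ : v₁ ∈ Set.Icc (1 / 2 : ℝ) 2) :
    ∫ v in Set.Icc (1 / 2 : ℝ) 2 ∩ Set.Icc (c - 1 / B) (c + 1 / B), ‖Rfun W (v / v₁)‖ * ‖Rfun W v‖ ≤
      Real.sqrt 2 / B * (fB W B (c / v₁)) ^ (1 / 2 : ℝ) * (fB W B c) ^ (1 / 2 : ℝ) := by
  set S : Set ℝ := Set.Icc (1 / 2 : ℝ) 2 ∩ Set.Icc (c - 1 / B) (c + 1 / B) with hS
  set μ := (volume : Measure ℝ).restrict S with hμ
  haveI : IsFiniteMeasure μ := by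
    rw [hμ]
    refine ⟨?_⟩
    rw [Measure.restrict_apply_univ]
    exact (measure_mono Set.inter_subset_left).trans_lt (by rw [Real.volume_Icc]; exact ENNReal.ofReal_lt_top)
  have hK := norm_Rfun_le W
  have hm1 : AEStronglyMeasurable (fun v ↦ ‖Rfun W (v / v₁)‖) μ :=
    ((measurable_Rfun W).comp (measurable_id.div_const v₁)).norm.aestronglyMeasurable
  have hm2 : AEStronglyMeasurable (fun v ↦ ‖Rfun W v‖) μ := (measurable_Rfun W).norm.aestronglyMeasurable
  have hf : MemLp (fun v ↦ ‖Rfun W (v / v₁)‖) (ENNReal.ofReal 2) μ :=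
    MemLp.of_bound hm1 (W.card : ℝ) (Eventually.of_forall fun v ↦ by rw [Real.norm_eq_abs, abs_norm]; exact hK _)
  have hg : MemLp (fun v ↦ ‖Rfun W v‖) (ENNReal.ofReal 2) μ :=
    MemLp.of_bound hm2 (W.card : ℝ) (Eventually.of_forall fun v ↦ by rw [Real.norm_eq_abs, abs_norm]; exact hK _)
  have h := integral_mul_le_Lp_mul_Lq_of_nonneg (μ := μ) Real.HolderConjugate.two_two
    (Eventually.of_forall fun v ↦ norm_nonneg _) (Eventually.of_forall fun v ↦ norm_nonneg _) hf hg
  have e2 : ∀ x : ℝ, (‖Rfun W x‖) ^ (2 : ℝ) = ‖Rfun W x‖ ^ 2 := fun x ↦ Real.rpow_two _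
  simp only [e2] at h
  refine h.trans ?_
  have h1 := setIntegral_normSq_div_le_fB W hB c hv₁
  have h2 := setIntegral_normSq_le_fB W hB c
  have hI1 : 0 ≤ ∫ v in S, ‖Rfun W (v / v₁)‖ ^ 2 := setIntegral_nonneg (measurableSet_Icc.inter measurableSet_Icc)
    fun v _ ↦ sq_nonneg _
  have hI2 : 0 ≤ ∫ v in S, ‖Rfun W v‖ ^ 2 := setIntegral_nonneg (measurableSet_Icc.inter measurableSet_Icc)
    fun v _ ↦ sq_nonneg _
  have hfB1 : 0 ≤ fB W B (c / v₁) := fB_nonneg W hB.le _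
  have hfB2 : 0 ≤ fB W B c := fB_nonneg W hB.le _
  calc (∫ v in S, ‖Rfun W (v / v₁)‖ ^ 2) ^ (1 / 2 : ℝ) * (∫ v in S, ‖Rfun W v‖ ^ 2) ^ (1 / 2 : ℝ)
      ≤ (2 * fB W B (c / v₁) / B) ^ (1 / 2 : ℝ) * (fB W B c / B) ^ (1 / 2 : ℝ) :=
        mul_le_mul (Real.rpow_le_rpow hI1 h1 (by norm_num)) (Real.rpow_le_rpow hI2 h2 (by norm_num))
          (Real.rpow_nonneg hI2 _) (Real.rpow_nonneg (by positivity) _)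
    _ = Real.sqrt 2 / B * (fB W B (c / v₁)) ^ (1 / 2 : ℝ) * (fB W B c) ^ (1 / 2 : ℝ) := by
        have h3 : (2 / B) ^ (1 / 2 : ℝ) * B⁻¹ ^ (1 / 2 : ℝ) = Real.sqrt 2 / B := by
          rw [← Real.mul_rpow (by positivity) (by positivity),
            show (2 / B * B⁻¹ : ℝ) = 2 / B ^ 2 by rw [← div_eq_mul_inv, div_div, ← sq],
            Real.div_rpow zero_le_two (by positivity), Real.sqrt_eq_rpow,
            show ((B ^ 2 : ℝ)) ^ (1 / 2 : ℝ) = B by rw [← Real.sqrt_eq_rpow, Real.sqrt_sq hB.le]]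
        rw [show 2 * fB W B (c / v₁) / B = (2 / B) * fB W B (c / v₁) by ring,
          show fB W B c / B = B⁻¹ * fB W B c by ring,
          Real.mul_rpow (by positivity) hfB1, Real.mul_rpow (by positivity) hfB2, ← h3]
        ring

/-- **The inner bound (Cauchy–Schwarz in `v₂` with the localising weight)**: for `v₁ ∈ [1/2,2]`, `B > 0`,
`c ∈ ℝ` and a weight `wt` with `0 ≤ wt ≤ D` and `wt(v) ≤ δ₀` for `|v − c| > 1/B`,
`∫_{[1/2,2]} |R(v/v₁)||R(v)| wt(v) dv ≤ (√2D/B) f_B(c/v₁)^{1/2}f_B(c)^{1/2} + (3/2)δ₀|W|²`.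
[cite: GuthMaynard2026, proof of Proposition 7.2] -/
theorem inner_le (W : Finset ℝ) {B : ℝ} (hB : 0 < B) (c : ℝ) {v₁ : ℝ} (hv₁ : v₁ ∈ Set.Icc (1 / 2 : ℝ) 2)
    {wt : ℝ → ℝ} (hwtm : Measurable wt) {D δ₀ : ℝ} (hD : 0 ≤ D) (hδ₀ : 0 ≤ δ₀) (hwt0 : ∀ v, 0 ≤ wt v)
    (hwtD : ∀ v, wt v ≤ D) (hwtδ : ∀ v, 1 / B < |v - c| → wt v ≤ δ₀) :
    ∫ v in Set.Icc (1 / 2 : ℝ) 2, ‖Rfun W (v / v₁)‖ * ‖Rfun W v‖ * wt v ≤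
      Real.sqrt 2 * D / B * (fB W B (c / v₁)) ^ (1 / 2 : ℝ) * (fB W B c) ^ (1 / 2 : ℝ) +
        3 / 2 * δ₀ * (W.card : ℝ) ^ 2 := by
  set I : Set ℝ := Set.Icc (1 / 2 : ℝ) 2 with hI
  set J : Set ℝ := Set.Icc (c - 1 / B) (c + 1 / B) with hJ
  set F : ℝ → ℝ := fun v ↦ ‖Rfun W (v / v₁)‖ * ‖Rfun W v‖ with hF
  have hF0 : ∀ v, 0 ≤ F v := fun v ↦ by positivity
  have hFK : ∀ v, F v ≤ (W.card : ℝ) ^ 2 := by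
    intro v
    have h1 := norm_Rfun_le W (v / v₁)
    have h2 := norm_Rfun_le W v
    calc F v ≤ W.card * W.card := mul_le_mul h1 h2 (norm_nonneg _) (Nat.cast_nonneg _)
      _ = _ := by ring
  have hFm : Measurable F :=
    (((measurable_Rfun W).comp (measurable_id.div_const v₁)).norm).mul (measurable_Rfun W).norm
  -- pointwise split of the weight
  have hsplit : ∀ v, F v * wt v ≤ D * J.indicator F v + δ₀ * F v := by
    intro v
    by_cases hv : v ∈ J
    · rw [Set.indicator_of_mem hv]
      have := hwtD v
      have : F v * wt v ≤ F v * D := mul_le_mul_of_nonneg_left this (hF0 v)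
      nlinarith [hF0 v, hδ₀]
    · rw [Set.indicator_of_notMem hv, mul_zero, zero_add]
      have hvc : 1 / B < |v - c| := by
        have hB1 : 0 < 1 / B := by positivity
        rw [hJ, Set.mem_Icc, not_and_or] at hv
        rcases hv with hv | hv
        · push Not at hv; rw [abs_sub_comm, abs_of_pos (by linarith)]; linarith
        · push Not at hv; rw [abs_of_pos (by linarith)]; linarith
      have := hwtδ v hvc
      calc F v * wt v ≤ F v * δ₀ := mul_le_mul_of_nonneg_left this (hF0 v)
        _ = δ₀ * F v := mul_comm _ _
  -- integrability on `I`
  have hIfin : volume I < ⊤ := by rw [hI, Real.volume_Icc]; exact ENNReal.ofReal_lt_top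
  have hint1 : IntegrableOn (fun v ↦ F v * wt v) I :=
    Measure.integrableOn_of_bounded (M := (W.card : ℝ) ^ 2 * D) hIfin.ne (hFm.mul hwtm).aestronglyMeasurable
      (Eventually.of_forall fun v ↦ by
        rw [Real.norm_of_nonneg (mul_nonneg (hF0 v) (hwt0 v))]
        exact mul_le_mul (hFK v) (hwtD v) (hwt0 v) (by positivity))
  have hFint_on : IntegrableOn F I :=
    Measure.integrableOn_of_bounded (M := (W.card : ℝ) ^ 2) hIfin.ne hFm.aestronglyMeasurable
      (Eventually.of_forall fun v ↦ by rw [Real.norm_of_nonneg (hF0 v)]; exact hFK v)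
  have hintA : IntegrableOn (fun v ↦ D * J.indicator F v) I := (hFint_on.indicator measurableSet_Icc).const_mul D
  have hintB : IntegrableOn (fun v ↦ δ₀ * F v) I := hFint_on.const_mul δ₀
  have hint2 : IntegrableOn (fun v ↦ D * J.indicator F v + δ₀ * F v) I := hintA.add hintB
  -- integrate
  have hstep : ∫ v in I, F v * wt v ≤ D * (∫ v in I ∩ J, F v) + δ₀ * ∫ v in I, F v := by
    calc ∫ v in I, F v * wt v ≤ ∫ v in I, (D * J.indicator F v + δ₀ * F v) :=
          setIntegral_mono_on hint1 hint2 measurableSet_Icc fun v _ ↦ hsplit v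
      _ = D * (∫ v in I ∩ J, F v) + δ₀ * ∫ v in I, F v := by
          rw [integral_add hintA hintB, integral_const_mul, integral_const_mul,
            setIntegral_indicator measurableSet_Icc]
  have hCS : ∫ v in I ∩ J, F v ≤ Real.sqrt 2 / B * (fB W B (c / v₁)) ^ (1 / 2 : ℝ) * (fB W B c) ^ (1 / 2 : ℝ) :=
    setIntegral_prod_le W hB c hv₁
  have hFint : ∫ v in I, F v ≤ 3 / 2 * (W.card : ℝ) ^ 2 := by
    have := MeasureTheory.norm_setIntegral_le_of_norm_le_const (s := I) (C := (W.card : ℝ) ^ 2) hIfin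
      (f := F) (fun v _ ↦ by rw [Real.norm_of_nonneg (hF0 v)]; exact hFK v)
    rw [hI, Real.volume_real_Icc_of_le (by norm_num)] at this
    refine (Real.le_norm_self _).trans (this.trans (le_of_eq ?_))
    ring
  calc ∫ v in I, F v * wt v ≤ D * (∫ v in I ∩ J, F v) + δ₀ * ∫ v in I, F v := hstep
    _ ≤ D * (Real.sqrt 2 / B * (fB W B (c / v₁)) ^ (1 / 2 : ℝ) * (fB W B c) ^ (1 / 2 : ℝ)) +
        δ₀ * (3 / 2 * (W.card : ℝ) ^ 2) :=
        add_le_add (mul_le_mul_of_nonneg_left hCS hD) (mul_le_mul_of_nonneg_left hFint hδ₀)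
    _ = _ := by ring

/-! ## §3. Proposition 7.2 for one term -/

/-- The majorant of Proposition 7.1:
`N³ ∫∫_{[1/2,2]²} |R(v₁)||R(v₂/v₁)||R(v₂)| D(1+|N(m₁v₁+m₂v₂+m₃)|)^{-j} dv₂ dv₁`.
[cite: GuthMaynard2026, Proposition 7.1] -/
def ImMajorant (D : ℝ) (j : ℕ) (N : ℕ) (W : Finset ℝ) (m : ℤ × ℤ × ℤ) : ℝ :=
  (N : ℝ) ^ 3 * ∫ v₁ in Set.Icc (1 / 2 : ℝ) 2, ∫ v in Set.Icc (1 / 2 : ℝ) 2,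
    ‖Rfun W v₁‖ * ‖Rfun W (v / v₁)‖ * ‖Rfun W v‖ * (D / (1 + |theta N m v₁ v|) ^ j)

/-- **Proposition 7.1** restated: `|I_m| ≤ ImMajorant D j N W m` for a `D` depending only on `w, j`.
[cite: GuthMaynard2026, Proposition 7.1] -/
theorem norm_Im_le_majorant {w : ℝ → ℝ} (hw : ContDiff ℝ ∞ w) (hsupp : Function.support w ⊆ Set.Icc 1 2)
    (j : ℕ) : ∃ D, 0 ≤ D ∧ ∀ (N : ℕ) (W : Finset ℝ) (m : ℤ × ℤ × ℤ), ‖Im w N W m‖ ≤ ImMajorant D j N W m :=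
  norm_Im_le hw hsupp j

/-- The integrand of the majorant is bounded, measurable, and integrable on the box. [folklore] -/
theorem majorantIntegrand_integrable {D : ℝ} (hD0 : 0 ≤ D) (j : ℕ) (N : ℕ) (W : Finset ℝ) (m : ℤ × ℤ × ℤ) :
    Integrable (Function.uncurry fun v₁ v ↦
        ‖Rfun W v₁‖ * ‖Rfun W (v / v₁)‖ * ‖Rfun W v‖ * (D / (1 + |theta N m v₁ v|) ^ j))
      (((volume : Measure ℝ).restrict (Set.Icc (1 / 2 : ℝ) 2)).prod
        ((volume : Measure ℝ).restrict (Set.Icc (1 / 2 : ℝ) 2))) := by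
  set I : Set ℝ := Set.Icc (1 / 2 : ℝ) 2 with hI
  set maj : ℝ × ℝ → ℝ := fun q ↦ ‖Rfun W q.1‖ * ‖Rfun W (q.2 / q.1)‖ * ‖Rfun W q.2‖ *
    (D / (1 + |theta N m q.1 q.2|) ^ j) with hmaj
  have hwtD : ∀ v₁ v, D / (1 + |theta N m v₁ v|) ^ j ≤ D := fun v₁ v ↦
    div_le_self hD0 (one_le_pow₀ (by have := abs_nonneg (theta N m v₁ v); linarith))
  have hmajm : Measurable maj := by
    have h1 : Measurable fun q : ℝ × ℝ ↦ ‖Rfun W q.1‖ := (measurable_Rfun W).norm.comp measurable_fst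
    have h2 : Measurable fun q : ℝ × ℝ ↦ ‖Rfun W (q.2 / q.1)‖ :=
      (measurable_Rfun W).norm.comp (measurable_snd.div measurable_fst)
    have h3 : Measurable fun q : ℝ × ℝ ↦ ‖Rfun W q.2‖ := (measurable_Rfun W).norm.comp measurable_snd
    have h4 : Measurable fun q : ℝ × ℝ ↦ D / (1 + |theta N m q.1 q.2|) ^ j := by simp only [theta]; fun_prop
    exact ((h1.mul h2).mul h3).mul h4
  have hmajb : ∀ q, ‖maj q‖ ≤ (W.card : ℝ) ^ 3 * D := by
    intro q
    have h1 := norm_Rfun_le W q.1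
    have h2 := norm_Rfun_le W (q.2 / q.1)
    have h3 := norm_Rfun_le W q.2
    rw [Real.norm_of_nonneg (by positivity)]
    calc maj q = ‖Rfun W q.1‖ * ‖Rfun W (q.2 / q.1)‖ * ‖Rfun W q.2‖ * (D / (1 + |theta N m q.1 q.2|) ^ j) := rfl
      _ ≤ W.card * W.card * W.card * D := by gcongr; exact hwtD _ _
      _ = (W.card : ℝ) ^ 3 * D := by ring
  have hboxfin : (volume : Measure (ℝ × ℝ)) (I ×ˢ I) ≠ ⊤ := by
    rw [Measure.volume_eq_prod, Measure.prod_prod, hI, Real.volume_Icc]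
    exact ENNReal.mul_ne_top ENNReal.ofReal_ne_top ENNReal.ofReal_ne_top
  have hmaji : IntegrableOn maj (I ×ˢ I) :=
    Measure.integrableOn_of_bounded hboxfin hmajm.aestronglyMeasurable (Eventually.of_forall hmajb)
  have hmaji2 : Integrable maj ((volume.restrict I).prod (volume.restrict I)) := by
    rw [Measure.prod_restrict, ← Measure.volume_eq_prod]; exact hmaji
  exact hmaji2

/-- **Symmetry of the majorant** under `(m₁, v₁) ↔ (m₂, v₂)` (Fubini on the box and `|R(v₁/v₂)| = |R(v₂/v₁)|`):
this is how the blocks with `|m₁| > |m₂|` are reduced to those with `|m₁| ≤ |m₂|` ("we can restrict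
attention to `m` with `0 < |m₁| ≤ |m₂|`"). [cite: GuthMaynard2026, proof of Proposition 7.2] -/
theorem majorant_swap {D : ℝ} (hD0 : 0 ≤ D) (j : ℕ) (N : ℕ) (W : Finset ℝ) (m₁ m₂ m₃ : ℤ) :
    ImMajorant D j N W (m₁, m₂, m₃) = ImMajorant D j N W (m₂, m₁, m₃) := by
  unfold ImMajorant
  congr 1
  have hswap := integral_integral_swap (majorantIntegrand_integrable hD0 j N W (m₁, m₂, m₃))
  rw [hswap]
  refine setIntegral_congr_fun measurableSet_Icc fun a _ ↦ setIntegral_congr_fun measurableSet_Icc fun b _ ↦ ?_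
  have h1 : ‖Rfun W (a / b)‖ = ‖Rfun W (b / a)‖ := by
    rw [← norm_Rfun_inv W (b / a), one_div_div]
  have h2 : theta N (m₁, m₂, m₃) b a = theta N (m₂, m₁, m₃) a b := by
    simp only [theta]; ring
  rw [h1, h2]
  ring

set_option maxHeartbeats 1600000 in
/-- **Guth–Maynard Proposition 7.2, one term, for the majorant.** For `η > 0`, `j`, `D ≥ 0`, `N ≥ 1`,
finite `W`, reals `1 ≤ M₂ ≤ |m₂|` and `B = NM₂N^{-η}`,
`ImMajorant D j N W m ≤ (9D/4) (N³/B) ∫_{[1/2,2]} |R(v)| f_B(A_m v)^{1/2} f_B(B_m v)^{1/2} dv + (9D/4) N³|W|³N^{-ηj}`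
(the localisation `|v₂ − B_m(v₁)| ≤ 1/B` outside which the weight is `≤ DN^{-ηj}`, and Cauchy–Schwarz in
`v₂`). [cite: GuthMaynard2026, Proposition 7.2] -/
theorem majorant_le_localised {η : ℝ} (hη : 0 < η) (j : ℕ) {D : ℝ} (hD0 : 0 ≤ D) {N : ℕ} (hN : 1 ≤ N)
    (W : Finset ℝ) {M₂ : ℝ} (_hM₂ : 1 ≤ M₂) (m : ℤ × ℤ × ℤ) (hm : M₂ ≤ |(m.2.1 : ℝ)|) :
    ImMajorant D j N W m ≤ (9 / 4 * D) * ((N : ℝ) ^ 3 / ((N : ℝ) * M₂ / (N : ℝ) ^ η)) *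
          (∫ v in Set.Icc (1 / 2 : ℝ) 2, ‖Rfun W v‖ *
            ((fB W ((N : ℝ) * M₂ / (N : ℝ) ^ η) (affA m v)) ^ (1 / 2 : ℝ) *
              (fB W ((N : ℝ) * M₂ / (N : ℝ) ^ η) (affB m v)) ^ (1 / 2 : ℝ))) +
        (9 / 4 * D) * (N : ℝ) ^ 3 * (W.card : ℝ) ^ 3 * (N : ℝ) ^ (-(η * j)) := by
  have hN0 : (0 : ℝ) < N := by exact_mod_cast hN
  have hN1 : (1 : ℝ) ≤ N := by exact_mod_cast hN
  set B : ℝ := (N : ℝ) * M₂ / (N : ℝ) ^ η with hB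
  have hNη : 1 ≤ (N : ℝ) ^ η := Real.one_le_rpow hN1 hη.le
  have hB0 : 0 < B := by rw [hB]; positivity
  have hm0 : m.2.1 ≠ 0 := by
    intro h; rw [h, Int.cast_zero, abs_zero] at hm; linarith
  set I : Set ℝ := Set.Icc (1 / 2 : ℝ) 2 with hI
  set K : ℝ := (W.card : ℝ) with hK
  set δ₀ : ℝ := D * (N : ℝ) ^ (-(η * j)) with hδ₀
  have hδ₀0 : 0 ≤ δ₀ := by positivity
  -- the weight for fixed `v₁`
  set wt : ℝ → ℝ → ℝ := fun v₁ v ↦ D / (1 + |theta N m v₁ v|) ^ j with hwt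
  have hwtm : ∀ v₁, Measurable (wt v₁) := fun v₁ ↦ by simp only [hwt, theta]; fun_prop
  have hwt0 : ∀ v₁ v, 0 ≤ wt v₁ v := fun v₁ v ↦ by positivity
  have hwtD : ∀ v₁ v, wt v₁ v ≤ D := fun v₁ v ↦
    div_le_self hD0 (one_le_pow₀ (by have := abs_nonneg (theta N m v₁ v); linarith))
  have hwtδ : ∀ v₁ v, 1 / B < |v - affB m v₁| → wt v₁ v ≤ δ₀ := by
    intro v₁ v hv
    simp only [hwt]
    rw [theta_eq N m hm0 v₁ v, hδ₀, Real.rpow_neg hN0.le, ← div_eq_mul_inv]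
    refine div_le_div_of_nonneg_left hD0 (by positivity) ?_
    -- `N^{ηj} ≤ (1 + |N m₂ (v - c)|)^j`
    have h1 : (N : ℝ) ^ η ≤ |(N : ℝ) * m.2.1 * (v - affB m v₁)| := by
      rw [abs_mul, abs_mul, abs_of_pos hN0]
      have h2 : (N : ℝ) ^ η = (N : ℝ) * M₂ * (1 / B) := by
        rw [hB]; field_simp
      rw [h2]
      exact mul_le_mul (mul_le_mul_of_nonneg_left hm hN0.le) hv.le (by positivity) (by positivity)
    calc (N : ℝ) ^ (η * j) = ((N : ℝ) ^ η) ^ j := by rw [Real.rpow_mul hN0.le, Real.rpow_natCast]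
      _ ≤ (1 + |(N : ℝ) * m.2.1 * (v - affB m v₁)|) ^ j := pow_le_pow_left₀ (by positivity) (by linarith) j
  -- the inner bound for each `v₁ ∈ I`
  have hinner : ∀ v₁ ∈ I, ∫ v in I, ‖Rfun W v₁‖ * ‖Rfun W (v / v₁)‖ * ‖Rfun W v‖ * wt v₁ v ≤
      ‖Rfun W v₁‖ * (Real.sqrt 2 * D / B * (fB W B (affA m v₁)) ^ (1 / 2 : ℝ) * (fB W B (affB m v₁)) ^ (1 / 2 : ℝ) +
        3 / 2 * δ₀ * K ^ 2) := by
    intro v₁ hv₁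
    have h := inner_le W hB0 (affB m v₁) hv₁ (hwtm v₁) hD0 hδ₀0 (hwt0 v₁) (hwtD v₁) (hwtδ v₁)
    have e : ∫ v in I, ‖Rfun W v₁‖ * ‖Rfun W (v / v₁)‖ * ‖Rfun W v‖ * wt v₁ v =
        ‖Rfun W v₁‖ * ∫ v in I, ‖Rfun W (v / v₁)‖ * ‖Rfun W v‖ * wt v₁ v := by
      rw [← integral_const_mul]
      refine integral_congr_ae (Eventually.of_forall fun v ↦ ?_)
      ring
    rw [e]
    refine mul_le_mul_of_nonneg_left ?_ (norm_nonneg _)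
    simpa only [affA] using h
  -- integrability of both sides of the outer inequality on `I`
  have hmaji2 := majorantIntegrand_integrable hD0 j N W m
  have hLint : IntegrableOn (fun v₁ ↦ ∫ v in I, ‖Rfun W v₁‖ * ‖Rfun W (v / v₁)‖ * ‖Rfun W v‖ * wt v₁ v) I :=
    hmaji2.integral_prod_left
  have hIfin : volume I < ⊤ := by rw [hI, Real.volume_Icc]; exact ENNReal.ofReal_lt_top
  -- the right-hand side is continuous on `I`, hence integrable
  set rhs : ℝ → ℝ := fun v₁ ↦ ‖Rfun W v₁‖ *
    (Real.sqrt 2 * D / B * (fB W B (affA m v₁)) ^ (1 / 2 : ℝ) * (fB W B (affB m v₁)) ^ (1 / 2 : ℝ) +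
      3 / 2 * δ₀ * K ^ 2) with hrhs
  have hrhs_cont : ContinuousOn rhs I := by
    have hcB : Continuous (affB m) := by unfold affB; fun_prop
    have hcA : ContinuousOn (affA m) I := by
      unfold affA
      exact hcB.continuousOn.div continuousOn_id fun v hv ↦ (by linarith [hv.1] : (0:ℝ) < v).ne'
    have hfBc := fB_continuous W hB0
    have h1 : ContinuousOn (fun v₁ ↦ ‖Rfun W v₁‖) I := fun v hv ↦
      (continuousAt_Rfun W (by linarith [hv.1] : (0:ℝ) < v).ne').norm.continuousWithinAt
    have h2 : ContinuousOn (fun v₁ ↦ (fB W B (affA m v₁)) ^ (1 / 2 : ℝ)) I :=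
      ((hfBc.comp_continuousOn hcA).rpow_const fun v _ ↦ Or.inr (by norm_num))
    have h3 : Continuous (fun v₁ ↦ (fB W B (affB m v₁)) ^ (1 / 2 : ℝ)) :=
      (hfBc.comp hcB).rpow_const fun v ↦ Or.inr (by norm_num)
    simp only [hrhs]
    exact h1.mul (((continuousOn_const.mul h2).mul h3.continuousOn).add continuousOn_const)
  have hRint : IntegrableOn rhs I := hrhs_cont.integrableOn_Icc
  -- the outer integral
  have houter : ∫ v₁ in I, ∫ v in I, ‖Rfun W v₁‖ * ‖Rfun W (v / v₁)‖ * ‖Rfun W v‖ * wt v₁ v ≤ ∫ v₁ in I, rhs v₁ :=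
    setIntegral_mono_on hLint hRint measurableSet_Icc hinner
  -- evaluate the right-hand side
  obtain ⟨main, hmain⟩ : ∃ x : ℝ, x = ∫ v in I, ‖Rfun W v‖ *
      ((fB W B (affA m v)) ^ (1 / 2 : ℝ) * (fB W B (affB m v)) ^ (1 / 2 : ℝ)) := ⟨_, rfl⟩
  have hmain0 : 0 ≤ main := by
    rw [hmain]
    exact setIntegral_nonneg measurableSet_Icc fun v _ ↦ by
      have := fB_nonneg W hB0.le (affA m v); have := fB_nonneg W hB0.le (affB m v); positivity
  have hRnorm : ∫ v in I, ‖Rfun W v‖ ≤ 3 / 2 * K := by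
    have := MeasureTheory.norm_setIntegral_le_of_norm_le_const (s := I) (C := K) hIfin
      (f := fun v ↦ ‖Rfun W v‖) (fun v _ ↦ by rw [norm_norm]; exact norm_Rfun_le W v)
    rw [hI, Real.volume_real_Icc_of_le (by norm_num)] at this
    refine (Real.le_norm_self _).trans (this.trans (le_of_eq ?_))
    ring
  have hrhs_int : ∫ v₁ in I, rhs v₁ = Real.sqrt 2 * D / B * main + 3 / 2 * δ₀ * K ^ 2 * ∫ v in I, ‖Rfun W v‖ := by
    have hi1 : IntegrableOn (fun v₁ ↦ Real.sqrt 2 * D / B *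
        (‖Rfun W v₁‖ * ((fB W B (affA m v₁)) ^ (1 / 2 : ℝ) * (fB W B (affB m v₁)) ^ (1 / 2 : ℝ)))) I := by
      refine ContinuousOn.integrableOn_Icc ?_
      have hcB : Continuous (affB m) := by unfold affB; fun_prop
      have hcA : ContinuousOn (affA m) I := by
        unfold affA
        exact hcB.continuousOn.div continuousOn_id fun v hv ↦ (by linarith [hv.1] : (0:ℝ) < v).ne'
      have hfBc := fB_continuous W hB0
      have h1 : ContinuousOn (fun v₁ ↦ ‖Rfun W v₁‖) I := fun v hv ↦
        (continuousAt_Rfun W (by linarith [hv.1] : (0:ℝ) < v).ne').norm.continuousWithinAt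
      have h2 : ContinuousOn (fun v₁ ↦ (fB W B (affA m v₁)) ^ (1 / 2 : ℝ)) I :=
        ((hfBc.comp_continuousOn hcA).rpow_const fun v _ ↦ Or.inr (by norm_num))
      have h3 : Continuous (fun v₁ ↦ (fB W B (affB m v₁)) ^ (1 / 2 : ℝ)) :=
        (hfBc.comp hcB).rpow_const fun v ↦ Or.inr (by norm_num)
      exact continuousOn_const.mul (h1.mul (h2.mul h3.continuousOn))
    have hi2 : IntegrableOn (fun v₁ ↦ 3 / 2 * δ₀ * K ^ 2 * ‖Rfun W v₁‖) I := by
      refine ContinuousOn.integrableOn_Icc (continuousOn_const.mul fun v hv ↦ ?_)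
      exact (continuousAt_Rfun W (by linarith [hv.1] : (0:ℝ) < v).ne').norm.continuousWithinAt
    have e : ∀ v₁, rhs v₁ = Real.sqrt 2 * D / B *
        (‖Rfun W v₁‖ * ((fB W B (affA m v₁)) ^ (1 / 2 : ℝ) * (fB W B (affB m v₁)) ^ (1 / 2 : ℝ))) +
        3 / 2 * δ₀ * K ^ 2 * ‖Rfun W v₁‖ := fun v₁ ↦ by simp only [hrhs]; ring
    simp_rw [e]
    rw [integral_add hi1 hi2, integral_const_mul, integral_const_mul, hmain]
  -- assemble
  have hC1 : Real.sqrt 2 * D ≤ 9 / 4 * D := by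
    refine mul_le_mul_of_nonneg_right ?_ hD0
    rw [Real.sqrt_le_left (by norm_num)]; norm_num
  have hK0 : 0 ≤ K := Nat.cast_nonneg _
  calc ImMajorant D j N W m = (N : ℝ) ^ 3 * ∫ v₁ in I, ∫ v in I,
        ‖Rfun W v₁‖ * ‖Rfun W (v / v₁)‖ * ‖Rfun W v‖ * (D / (1 + |theta N m v₁ v|) ^ j) := rfl
    _ ≤ (N : ℝ) ^ 3 * ∫ v₁ in I, rhs v₁ := mul_le_mul_of_nonneg_left houter (by positivity)
    _ = (N : ℝ) ^ 3 * (Real.sqrt 2 * D / B * main + 3 / 2 * δ₀ * K ^ 2 * ∫ v in I, ‖Rfun W v‖) := by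
        rw [hrhs_int]
    _ ≤ (N : ℝ) ^ 3 * (Real.sqrt 2 * D / B * main + 3 / 2 * δ₀ * K ^ 2 * (3 / 2 * K)) := by
        gcongr
    _ = (Real.sqrt 2 * D) * ((N : ℝ) ^ 3 / B) * main + (9 / 4 * D) * (N : ℝ) ^ 3 * K ^ 3 * (N : ℝ) ^ (-(η * j)) := by
        rw [hδ₀]; ring
    _ ≤ (9 / 4 * D) * ((N : ℝ) ^ 3 / B) * main + (9 / 4 * D) * (N : ℝ) ^ 3 * K ^ 3 * (N : ℝ) ^ (-(η * j)) := by
        gcongr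
    _ = _ := by rw [hmain]

/-- **Guth–Maynard Proposition 7.2, one term.** For `η > 0` and `j` there is `C` (depending on `w, η, j`)
such that for `N ≥ 1`, finite `W`, reals `1 ≤ M₂ ≤ |m₂|` and `B = NM₂N^{-η}`,
`|I_m| ≤ C (N³/B) ∫_{[1/2,2]} |R(v)| f_B(A_m v)^{1/2} f_B(B_m v)^{1/2} dv + C N³|W|³N^{-ηj}`
("`|I_{m₁,m₂,m₃}| ≪ (N²/M) Ĩ_{m₁,−m₂,m₃} + O(T^{-100})`"). [cite: GuthMaynard2026, Proposition 7.2] -/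
theorem norm_Im_le_localised {w : ℝ → ℝ} (hw : ContDiff ℝ ∞ w) (hsupp : Function.support w ⊆ Set.Icc 1 2)
    {η : ℝ} (hη : 0 < η) (j : ℕ) : ∃ C, 0 ≤ C ∧ ∀ (N : ℕ), 1 ≤ N → ∀ (W : Finset ℝ) (M₂ : ℝ), 1 ≤ M₂ →
      ∀ m : ℤ × ℤ × ℤ, M₂ ≤ |(m.2.1 : ℝ)| →
      ‖Im w N W m‖ ≤ C * ((N : ℝ) ^ 3 / ((N : ℝ) * M₂ / (N : ℝ) ^ η)) *
          (∫ v in Set.Icc (1 / 2 : ℝ) 2, ‖Rfun W v‖ *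
            ((fB W ((N : ℝ) * M₂ / (N : ℝ) ^ η) (affA m v)) ^ (1 / 2 : ℝ) *
              (fB W ((N : ℝ) * M₂ / (N : ℝ) ^ η) (affB m v)) ^ (1 / 2 : ℝ))) +
        C * (N : ℝ) ^ 3 * (W.card : ℝ) ^ 3 * (N : ℝ) ^ (-(η * j)) := by
  obtain ⟨D, hD0, hD⟩ := norm_Im_le_majorant hw hsupp j
  refine ⟨9 / 4 * D, by positivity, fun N hN W M₂ hM₂ m hm ↦ ?_⟩
  exact (hD N W m).trans (majorant_le_localised hη j hD0 hN W hM₂ m hm)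

/-- **Proposition 7.2, one term, localised in `v₁` instead** (for the blocks with `|m₁| ≥ M₁`): the same
bound with the roles of `(m₁, v₁)` and `(m₂, v₂)` exchanged, i.e. with `A, B` of the swapped triple
`(m₂, m₁, m₃)` and `B = NM₁N^{-η}`. [cite: GuthMaynard2026, Proposition 7.2] -/
theorem norm_Im_le_localised_fst {w : ℝ → ℝ} (hw : ContDiff ℝ ∞ w) (hsupp : Function.support w ⊆ Set.Icc 1 2)
    {η : ℝ} (hη : 0 < η) (j : ℕ) : ∃ C, 0 ≤ C ∧ ∀ (N : ℕ), 1 ≤ N → ∀ (W : Finset ℝ) (M₁ : ℝ), 1 ≤ M₁ →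
      ∀ m : ℤ × ℤ × ℤ, M₁ ≤ |(m.1 : ℝ)| →
      ‖Im w N W m‖ ≤ C * ((N : ℝ) ^ 3 / ((N : ℝ) * M₁ / (N : ℝ) ^ η)) *
          (∫ v in Set.Icc (1 / 2 : ℝ) 2, ‖Rfun W v‖ *
            ((fB W ((N : ℝ) * M₁ / (N : ℝ) ^ η) (affA (m.2.1, m.1, m.2.2) v)) ^ (1 / 2 : ℝ) *
              (fB W ((N : ℝ) * M₁ / (N : ℝ) ^ η) (affB (m.2.1, m.1, m.2.2) v)) ^ (1 / 2 : ℝ))) +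
        C * (N : ℝ) ^ 3 * (W.card : ℝ) ^ 3 * (N : ℝ) ^ (-(η * j)) := by
  obtain ⟨D, hD0, hD⟩ := norm_Im_le_majorant hw hsupp j
  refine ⟨9 / 4 * D, by positivity, fun N hN W M₁ hM₁ m hm ↦ ?_⟩
  obtain ⟨m₁, m₂, m₃⟩ := m
  have h1 : ‖Im w N W (m₁, m₂, m₃)‖ ≤ ImMajorant D j N W (m₂, m₁, m₃) := by
    rw [← majorant_swap hD0]; exact hD N W _
  exact h1.trans (majorant_le_localised hη j hD0 hN W hM₁ (m₂, m₁, m₃) hm)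

/-! ## §4. Dyadic shells of `𝓜` (used for the block decomposition of `∑_m |I_m|`) -/

/-- The dyadic shell `{m ∈ 𝓜_{M₀} : ⌊log₂ |m|⌋ = i}`. [cite: GuthMaynard2026, proof of Proposition 7.2] -/
def shell (M₀ i : ℕ) : Finset ℤ := (Mset M₀).filter fun m ↦ Nat.log 2 m.natAbs = i

/-- Membership in a shell. [folklore] -/
theorem mem_shell {M₀ i : ℕ} {m : ℤ} : m ∈ shell M₀ i ↔ m ∈ Mset M₀ ∧ Nat.log 2 m.natAbs = i :=
  Finset.mem_filter

/-- Elements of a shell are non-zero. [folklore] -/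
theorem ne_zero_of_mem_shell {M₀ i : ℕ} {m : ℤ} (hm : m ∈ shell M₀ i) : m ≠ 0 :=
  (mem_Mset.mp (mem_shell.mp hm).1).1

/-- `2^i ≤ |m| ≤ 2·2^i` on the shell. [folklore] -/
theorem shell_bounds {M₀ i : ℕ} {m : ℤ} (hm : m ∈ shell M₀ i) :
    (2 : ℝ) ^ i ≤ |(m : ℝ)| ∧ |(m : ℝ)| ≤ 2 * 2 ^ i := by
  rw [mem_shell, mem_Mset] at hm
  obtain ⟨⟨hm0, -, -⟩, hlog⟩ := hm
  have hn : m.natAbs ≠ 0 := Int.natAbs_ne_zero.mpr hm0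
  have h1 : 2 ^ i ≤ m.natAbs := hlog ▸ Nat.pow_log_le_self 2 hn
  have h2 : m.natAbs < 2 ^ (i + 1) := hlog ▸ Nat.lt_pow_succ_log_self one_lt_two _
  have e : ((m.natAbs : ℕ) : ℝ) = |(m : ℝ)| := by rw [Nat.cast_natAbs, Int.cast_abs]
  rw [← e]
  constructor
  · exact_mod_cast h1
  · have : ((m.natAbs : ℕ) : ℝ) < 2 ^ (i + 1) := by exact_mod_cast h2
    rw [pow_succ] at this
    linarith

/-- `|m| ≤ M₀` on the shell. [folklore] -/
theorem abs_le_of_mem_shell {M₀ i : ℕ} {m : ℤ} (hm : m ∈ shell M₀ i) : |(m : ℝ)| ≤ M₀ := by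
  rw [mem_shell, mem_Mset] at hm
  obtain ⟨⟨-, h1, h2⟩, -⟩ := hm
  rw [abs_le]; constructor <;> exact_mod_cast (by omega)

/-- A shell is symmetric under `m ↦ −m`. [folklore] -/
theorem neg_mem_shell {M₀ i : ℕ} {m : ℤ} (hm : m ∈ shell M₀ i) : -m ∈ shell M₀ i := by
  rw [mem_shell, mem_Mset] at hm ⊢
  obtain ⟨⟨hm0, h1, h2⟩, hlog⟩ := hm
  exact ⟨⟨neg_ne_zero.mpr hm0, by omega, by omega⟩, by rwa [Int.natAbs_neg]⟩

/-- Reindexing a sum over a shell by `m ↦ −m`. [folklore] -/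
theorem sum_shell_neg {M₀ i : ℕ} (G : ℤ → ℝ) : ∑ m ∈ shell M₀ i, G (-m) = ∑ m ∈ shell M₀ i, G m :=
  Finset.sum_nbij' (fun m ↦ -m) (fun m ↦ -m) (fun _ hm ↦ neg_mem_shell hm) (fun _ hm ↦ neg_mem_shell hm)
    (fun m _ ↦ neg_neg m) (fun m _ ↦ neg_neg m) (fun _ _ ↦ rfl)

/-- A shell lies in `[−2^{i+1}, 2^{i+1}]`. [folklore] -/
theorem shell_subset_Icc (M₀ i : ℕ) :
    shell M₀ i ⊆ Finset.Icc (-((2 ^ (i + 1) : ℕ) : ℤ)) ((2 ^ (i + 1) : ℕ) : ℤ) := by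
  intro m hm
  have h := shell_bounds hm
  rw [Finset.mem_Icc]
  have h2 : |(m : ℝ)| ≤ ((2 ^ (i + 1) : ℕ) : ℝ) := by push_cast; rw [pow_succ]; linarith [h.2]
  rw [abs_le] at h2
  constructor
  · have : (-((2 ^ (i + 1) : ℕ) : ℤ) : ℝ) ≤ (m : ℝ) := by push_cast at h2 ⊢; linarith [h2.1]
    exact_mod_cast this
  · have : (m : ℝ) ≤ (((2 ^ (i + 1) : ℕ) : ℤ) : ℝ) := by push_cast at h2 ⊢; linarith [h2.2]
    exact_mod_cast this

/-- The shells with `i ≤ log₂ M₀` cover `𝓜_{M₀}`. [folklore] -/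
theorem log_mem_range {M₀ : ℕ} {m : ℤ} (hm : m ∈ Mset M₀) : Nat.log 2 m.natAbs ∈ Finset.range (Nat.log 2 M₀ + 1) := by
  rw [Finset.mem_range, Nat.lt_succ_iff]
  rw [mem_Mset] at hm
  exact Nat.log_mono_right (by omega)

/-- **Dyadic decomposition of `∑_{m ∈ 𝓜³}`** into blocks `shell i₁ × shell i₂ × shell i₃`.
[cite: GuthMaynard2026, proof of Proposition 7.2 (dyadic ranges `|m_i| ∼ M_i`)] -/
theorem sum_Mset3_eq_sum_blocks (M₀ : ℕ) (F : ℤ × ℤ × ℤ → ℝ) :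
    ∑ m ∈ Mset M₀ ×ˢ (Mset M₀ ×ˢ Mset M₀), F m =
      ∑ b ∈ Finset.range (Nat.log 2 M₀ + 1) ×ˢ (Finset.range (Nat.log 2 M₀ + 1) ×ˢ Finset.range (Nat.log 2 M₀ + 1)),
        ∑ m ∈ shell M₀ b.1 ×ˢ (shell M₀ b.2.1 ×ˢ shell M₀ b.2.2), F m := by
  classical
  set g : ℤ × ℤ × ℤ → ℕ × ℕ × ℕ := fun m ↦ (Nat.log 2 m.1.natAbs, Nat.log 2 m.2.1.natAbs, Nat.log 2 m.2.2.natAbs)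
    with hg
  set R := Finset.range (Nat.log 2 M₀ + 1) with hR
  have hmaps : ∀ m ∈ Mset M₀ ×ˢ (Mset M₀ ×ˢ Mset M₀), g m ∈ R ×ˢ (R ×ˢ R) := by
    intro m hm
    simp only [Finset.mem_product] at hm ⊢
    exact ⟨log_mem_range hm.1, log_mem_range hm.2.1, log_mem_range hm.2.2⟩
  rw [← Finset.sum_fiberwise_of_maps_to hmaps]
  refine Finset.sum_congr rfl fun b _ ↦ ?_
  apply Finset.sum_congr
  · ext m
    simp only [Finset.mem_filter, Finset.mem_product, shell, hg, Prod.ext_iff]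
    tauto
  · intro m _; rfl

/-- The size of a block: `|shell i| ≤ 2M₀ + 1 ≤ 3M₀` (`M₀ ≥ 1`). [folklore] -/
theorem card_shell_le {M₀ : ℕ} (hM₀ : 1 ≤ M₀) (i : ℕ) : ((shell M₀ i).card : ℝ) ≤ 3 * M₀ := by
  have h1 : (shell M₀ i).card ≤ (Mset M₀).card := Finset.card_le_card (Finset.filter_subset _ _)
  have h2 : (Mset M₀).card ≤ (Finset.Icc (-(M₀ : ℤ)) M₀).card := Finset.card_le_card (Finset.erase_subset _ _)
  have h3 : ((Finset.Icc (-(M₀ : ℤ)) M₀).card : ℝ) = 2 * M₀ + 1 := by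
    rw [Int.card_Icc]
    have : ((M₀ : ℤ) + 1 - -(M₀ : ℤ)).toNat = 2 * M₀ + 1 := by omega
    rw [this]; push_cast; ring
  have hM : (1 : ℝ) ≤ M₀ := by exact_mod_cast hM₀
  calc ((shell M₀ i).card : ℝ) ≤ ((Finset.Icc (-(M₀ : ℤ)) M₀).card : ℝ) := by exact_mod_cast h1.trans h2
    _ = 2 * M₀ + 1 := h3
    _ ≤ 3 * M₀ := by linarith


end GuthMaynardS3Loc

end Literature.NumberTheory.LFunctions

end
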